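import Summits.PneNP.PneNP.Theorems.SymmetryBudgetNoHiddenOrderPerPathCGHeight
import Summits.PneNP.PneNP.Theorems.SymmetryBudgetNoHiddenOrderPerPathBudget

/-!
# The LABEL BUDGET of the certified-label scheme on the concrete process (`NoHiddenOrder`, glue g3b)

Route `PneNP/SymmetryBudget`, `NoHiddenOrder` (stmt-PneNP-14781). Completeness of the certified-label scheme over the components-only
Corneil–Goldberg process with pass-over HEIGHTS as values (`cg_val_ne_none_of_reach_hgt'`, `…PerPathCGHeight.lean`) leaves one
hypothesis: every label `(block, X, λ)` of the solution subtree is ADMISSIBLE. Here is what those labels look like — the input of the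
admissibility count: along the solution subtree from a start block with an equitable colouring (`reach_budget`),

* the named vertices are the OR-choices `x 0, …, x (t-1)` of a TIMED PATH (`timed`, `IsORChoice` of `…PerPathReplay.lean`) of length
  `t ≤ |V|`, pairwise distinct, and `λ` vanishes off them;
* the value recorded at `x k` is less than the size `d k` of the first smallest cell it was taken from (`hgt_le_card_smallestCell_sub_one`);
* **`Σ_{k<t} ⌊log₂ d k⌋ ≤ 4|V| + ⌊log₂ |V|⌋`** — the linear per-path bound `sum_log_smallestCell_le` (Theorem B / LogBranchSum) applied to
  the timed path of a second vertex of the current smallest cell taken as pointer (its start block is the atom of the pointer in the start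
  block, equitable and switching-connected by `equitableIn_atom`, `atom_connected`).

The bridge from `CertifiedLabels.Reach` to timed paths is the invariant `InvData`: for every unnamed vertex `v` of the current block, the
OR-nodes met so far are the states of a timed path with pointer `v`, the current colouring is its last colouring, and the current block is
an iterate of `B ↦ swReach G B col v` from the block before the last OR-node — so that the next OR-node (switching-connected) is the
atom, i.e. the next timed state (`atom_eq_iterate_of_fixed`, `timed_eq_of_invData`).

Main definitions: `St`, `pre`, `InvData`, `BudgetBound`. Main result: `reach_budget` (and `reach_budgetBound`).
-/

-- `Summit.PneNP.PneNP.…` duplicates `PneNP` BY DESIGN (single-problem summit, D-0017 layout).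
set_option linter.dupNamespace false

namespace Summit.PneNP.PneNP.Theorems

open Finset

namespace BranchSum

variable {V : Type*} [DecidableEq V] (G : SimpleGraph V) [DecidableRel G.Adj]

/-! ### Timed paths: congruence, extension, and the atom as an iterate -/

variable {G} in
/-- `timed … m` depends only on the choices below `m`. -/
theorem timed_congr {v : V} {S : Finset V × (V → ℕ)} {x x' : ℕ → V} {m : ℕ} (h : ∀ k, k < m → x' k = x k) :
    timed G v S x' m = timed G v S x m := by
  induction m with
  | zero => rfl
  | succ m ih => rw [timed_succ, timed_succ, ih fun k hk => h k (Nat.lt_succ_of_lt hk), h m (Nat.lt_succ_self m)]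

variable {G} in
/-- **Extending a timed path by one OR-choice** in the first smallest cell of its last state. -/
theorem isORChoice_extend {v : V} {S : Finset V × (V → ℕ)} {x : ℕ → V} {t : ℕ} (hORc : IsORChoice G v S x t)
    (hxv : ∀ k, k < t → x k ≠ v) {z : V} (h2 : 2 ≤ (timed G v S x t).1.card)
    (hz : z ∈ smallestCell (timed G v S x t).1 (timed G v S x t).2) (hzv : z ≠ v) :
    ∃ x' : ℕ → V, (∀ k, k < t → x' k = x k) ∧ x' t = z ∧ IsORChoice G v S x' (t + 1) ∧ (∀ k, k < t + 1 → x' k ≠ v) ∧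
      ∀ k, k ≤ t → timed G v S x' k = timed G v S x k := by
  refine ⟨fun k => if k < t then x k else z, fun k hk => if_pos hk, if_neg (lt_irrefl t), ?_, ?_, ?_⟩
  · intro k hk
    have hcongr : timed G v S (fun k => if k < t then x k else z) k = timed G v S x k :=
      timed_congr fun j hj => if_pos (hj.trans_le (Nat.lt_succ_iff.1 hk))
    rw [hcongr]
    rcases Nat.lt_succ_iff_lt_or_eq.1 hk with hk | rfl
    · simp only [hk, if_true]; exact hORc k hk
    · simp only [lt_irrefl, if_false]; exact ⟨h2, hz⟩
  · intro k hk
    rcases Nat.lt_succ_iff_lt_or_eq.1 hk with hk | rfl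
    · simp only [hk, if_true]; exact hxv k hk
    · simp only [lt_irrefl, if_false]; exact hzv
  · intro k hk
    exact timed_congr fun j hj => if_pos (hj.trans_le hk)

variable {G} in
/-- **A switching-connected iterate of the atom step is the atom.** -/
theorem atom_eq_iterate_of_fixed (W : Finset V) (c : V → ℕ) (v : V) (i : ℕ)
    (hfix : swReach G ((fun B => swReach G B c v)^[i] W) c v = (fun B => swReach G B c v)^[i] W) :
    atom G W c v = (fun B => swReach G B c v)^[i] W := by
  have hst := iterate_atomStep_stable W c v (n := i) (by rw [Function.iterate_succ_apply']; exact hfix)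
  obtain ⟨n₀, hn₀, hfix₀⟩ := exists_atomStep_fixed (G := G) W c v
  have hst₀ := iterate_atomStep_stable W c v hfix₀
  unfold atom
  by_cases hi : i ≤ W.card + 1
  · exact hst _ hi
  · rw [hst₀ (W.card + 1) (by omega)]
    exact (hst₀ i (by omega)).symm

/-! ### The invariant of a pointer along the solution subtree -/

variable (I₀ : CGInst V)

/-- The START STATE of the pointer `v`: its atom in the start block, with the start colouring. -/
noncomputable def St (v : V) : Finset V × (V → ℕ) := (atom G I₀.1.1 I₀.1.2 v, I₀.1.2)

/-- The block BEFORE the `t`-th OR-node of the timed path of `v` (the start block for `t = 0`). -/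
noncomputable def pre (v : V) (x : ℕ → V) : ℕ → Finset V
  | 0 => I₀.1.1
  | k + 1 => (timed G v (St G I₀ v) x k).1

/-- **The timed-path data of a pointer `v` at the node `(I, X, λ)`**: OR-choices `x` of length `t` forming a timed path for `v` and
avoiding `v`; the current colouring is the last colouring; the current block is an iterate of the atom step from the block before the
last OR-node; the named set is `{x k | k < t}`; each recorded value is below the size of the smallest cell it was taken from. -/
def InvData (I : CGInst V) (X : Finset V) (lam : V → ℕ) (v : V) : Prop :=
  ∃ (t : ℕ) (x : ℕ → V), IsORChoice G v (St G I₀ v) x t ∧ (∀ k, k < t → x k ≠ v) ∧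
    I.1.2 = (timed G v (St G I₀ v) x t).2 ∧
    (∃ i, I.1.1 = (fun B => swReach G B I.1.2 v)^[i] (pre G I₀ v x t)) ∧
    X = (range t).image x ∧
    ∀ k, k < t → lam (x k) + 1 ≤ (smallestCell (timed G v (St G I₀ v) x k).1 (timed G v (St G I₀ v) x k).2).card

/-- **The LABEL BUDGET**: the named set is enumerated without repetition by `x` on `range t`, `t ≤ |V|`, the values are dominated by
numbers `d k` with `Σ ⌊log₂ d k⌋ ≤ 4|V| + ⌊log₂|V|⌋`, and `λ` vanishes off the named set. -/
def BudgetBound [Fintype V] (X : Finset V) (lam : V → ℕ) : Prop :=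
  ∃ (t : ℕ) (x : ℕ → V) (d : ℕ → ℕ), t ≤ Fintype.card V ∧ Set.InjOn x ↑(range t) ∧ X = (range t).image x ∧
    (∀ k, k < t → lam (x k) + 1 ≤ d k) ∧
    ∑ k ∈ range t, Nat.log 2 (d k) ≤ 4 * Fintype.card V + Nat.log 2 (Fintype.card V) ∧
    ∀ y, y ∉ X → lam y = 0

variable {G I₀}

/-- The last timed state has the atom of the block before as its block. -/
theorem timed_fst_eq_atom (v : V) (x : ℕ → V) (t : ℕ) :
    (timed G v (St G I₀ v) x t).1 = atom G (pre G I₀ v x t) (timed G v (St G I₀ v) x t).2 v := by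
  cases t with
  | zero => rfl
  | succ k => rfl

/-- **At a switching-connected node the timed path of an unnamed pointer has arrived exactly there.** -/
theorem timed_eq_of_invData {I : CGInst V} (hconn : ∀ u ∈ I.1.1, swReach G I.1.1 I.1.2 u = I.1.1) {v : V} (hv : v ∈ I.1.1)
    {t : ℕ} {x : ℕ → V} (hcol : I.1.2 = (timed G v (St G I₀ v) x t).2)
    (hi : ∃ i, I.1.1 = (fun B => swReach G B I.1.2 v)^[i] (pre G I₀ v x t)) : timed G v (St G I₀ v) x t = I.1 := by
  obtain ⟨i, hi⟩ := hi
  refine Prod.ext ?_ hcol.symm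
  rw [timed_fst_eq_atom, ← hcol]
  have hfix : swReach G ((fun B => swReach G B I.1.2 v)^[i] (pre G I₀ v x t)) I.1.2 v =
      (fun B => swReach G B I.1.2 v)^[i] (pre G I₀ v x t) := by
    rw [← hi]; exact hconn v hv
  exact (atom_eq_iterate_of_fixed _ _ v i hfix).trans hi.symm

/-- Blocks of the solution subtree lie in the start block. -/
theorem block_subset_of_reach {sel : CGInst V → V} {hv : CGInst V → ℕ} {I : (cgProcess G).Inst} {X : Finset V} {lam : V → ℕ}
    (h : CertifiedLabels.Reach (cgProcess G) sel hv I₀ I X lam) : I.1.1 ⊆ I₀.1.1 := by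
  have hverts : ∀ J A ch, (cgProcess G).step J = .orNode A ch → (cgProcess G).verts (ch (sel J)) = (cgProcess G).verts J := by
    intro J A ch hJ
    obtain ⟨-, -, -, rfl⟩ := cgStep_eq_orNode_iff.1 hJ
    rfl
  exact (CertifiedLabels.reachFrom_root_of_reach h).verts_subset hverts

/-! ### The budget theorem -/

/-- **The invariant along the solution subtree** (selector `cgSel`, values the heights): the label budget holds and every unnamed
vertex of the block carries timed-path data. -/
theorem reach_budget [Fintype V]
    (hI₀ : ∀ u ∈ I₀.1.1, ∀ u' ∈ I₀.1.1, I₀.1.2 u = I₀.1.2 u' → ∀ w ∈ I₀.1.1,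
      ((cellOf I₀.1.1 I₀.1.2 w).filter fun y => G.Adj u y).card = ((cellOf I₀.1.1 I₀.1.2 w).filter fun y => G.Adj u' y).card)
    {I : (cgProcess G).Inst} {X : Finset V} {lam : V → ℕ}
    (h : CertifiedLabels.Reach (cgProcess G) (cgSel (V := V)) (hgt G cgSel) I₀ I X lam) :
    BudgetBound X lam ∧ ∀ v ∈ I.1.1, v ∉ X → InvData G I₀ I X lam v := by
  induction h with
  | root =>
    refine ⟨⟨0, fun _ => I₀.2.choose, fun _ => 0, Nat.zero_le _, by simp, by simp, fun k hk => absurd hk (Nat.not_lt_zero k),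
      by simp, fun _ _ => rfl⟩, fun v _ _ => ⟨0, fun _ => v, fun k hk => absurd hk (Nat.not_lt_zero k),
      fun k hk => absurd hk (Nat.not_lt_zero k), rfl, ⟨0, rfl⟩, by simp, fun k hk => absurd hk (Nat.not_lt_zero k)⟩⟩
  | @part I X lam ps J hR hs hJ ih =>
    change CGInst V at I J
    obtain ⟨hBB, hInv⟩ := ih
    obtain ⟨-, rfl⟩ := cgStep_eq_andNode_iff.1 hs
    obtain ⟨hcolJ, hK⟩ := mem_cgParts_iff.1 hJ
    obtain ⟨w, hw, hKw⟩ := mem_image.1 hK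
    refine ⟨hBB, fun v hv hvX => ?_⟩
    have hv' : v ∈ swReach G I.1.1 I.1.2 w := hKw ▸ hv
    have hvI : v ∈ I.1.1 := swReach_subset _ _ w hv'
    obtain ⟨t, x, hORc, hxv, hcol, ⟨i, hi⟩, hX, hlam⟩ := hInv v hvI hvX
    refine ⟨t, x, hORc, hxv, hcolJ.trans hcol, ⟨i + 1, ?_⟩, hX, hlam⟩
    rw [hcolJ, Function.iterate_succ_apply', ← hi, ← hKw]
    exact (swReach_eq_of_mem _ hw hv').symm
  | @child I X lam A ch hR hs ih =>
    change CGInst V at I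
    obtain ⟨hBB, hInv⟩ := ih
    have hx : cgSel I ∈ A := cgSel_mem I _ _ hs
    obtain ⟨hAND, hOR, rfl, rfl⟩ := cgStep_eq_orNode_iff.1 hs
    have hxA : cgSel I ∈ I.1.1 := smallestCell_subset _ _ hx
    have hconn : ∀ u ∈ I.1.1, swReach G I.1.1 I.1.2 u = I.1.1 := fun u hu => by
      by_contra hne; exact hAND ⟨u, hu, hne⟩
    -- named vertices still in the block are singletons, so the vertices of the smallest cell are unnamed
    have hfreshC : ∀ y ∈ smallestCell I.1.1 I.1.2, y ∉ X := fun y hy hyX => by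
      have hs1 := singleton_named_of_reach cgSel_mem hR y hyX (smallestCell_subset _ _ hy)
      have : (smallestCell I.1.1 I.1.2).card = 1 := by rw [smallestCell_eq_cellOf _ hy, hs1, card_singleton]
      omega
    -- the recorded value is below the size of the cell
    have hval : hgt G cgSel I + 1 ≤ (smallestCell I.1.1 I.1.2).card := by
      have := hgt_le_card_smallestCell_sub_one (G := G) cgSel_mem I
      omega
    have hsubI₀ : I.1.1 ⊆ I₀.1.1 := block_subset_of_reach hR
    have hlam0 : ∀ y, y ∉ X → lam y = 0 := by obtain ⟨_, _, _, _, _, _, _, _, h0⟩ := hBB; exact h0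
    -- timed data of an unnamed pointer `p ≠ cgSel I`, extended by the present OR-choice
    have hext : ∀ p ∈ I.1.1, p ∉ X → p ≠ cgSel I → ∃ (t : ℕ) (x x' : ℕ → V),
        IsORChoice G p (St G I₀ p) x' (t + 1) ∧ (∀ k, k < t + 1 → x' k ≠ p) ∧ (∀ k, k < t → x' k = x k) ∧ x' t = cgSel I ∧
        (∀ k, k ≤ t → timed G p (St G I₀ p) x' k = timed G p (St G I₀ p) x k) ∧ timed G p (St G I₀ p) x t = I.1 ∧
        X = (range t).image x ∧
        ∀ k, k < t → lam (x k) + 1 ≤ (smallestCell (timed G p (St G I₀ p) x k).1 (timed G p (St G I₀ p) x k).2).card := by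
      intro p hp hpX hpx
      obtain ⟨t, x, hORc, hxv, hcol, hi, hX, hlam⟩ := hInv p hp hpX
      have htimed : timed G p (St G I₀ p) x t = I.1 := timed_eq_of_invData hconn hp hcol hi
      have h2 : 2 ≤ (timed G p (St G I₀ p) x t).1.card := by rw [htimed]; exact hOR.1
      have hz : cgSel I ∈ smallestCell (timed G p (St G I₀ p) x t).1 (timed G p (St G I₀ p) x t).2 := by rw [htimed]; exact hx
      obtain ⟨x', hagx, hxt, hORc', hxv', hagree⟩ := isORChoice_extend hORc hxv h2 hz hpx.symm
      exact ⟨t, x, x', hORc', hxv', hagx, hxt, hagree, htimed, hX, hlam⟩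
    -- the enumeration and value facts for an extended path
    have henum : ∀ (t : ℕ) (x x' : ℕ → V), (∀ k, k < t → x' k = x k) → x' t = cgSel I → X = (range t).image x →
        insert (cgSel I) X = (range (t + 1)).image x' := by
      intro t x x' hagx hxt hX
      rw [range_add_one, image_insert, hxt, hX]
      congr 1
      exact (image_congr fun k hk => hagx k (mem_range.1 (mem_coe.1 hk))).symm
    have hvals : ∀ (p : V) (t : ℕ) (x x' : ℕ → V), (∀ k, k < t → x' k = x k) → x' t = cgSel I →
        (∀ k, k ≤ t → timed G p (St G I₀ p) x' k = timed G p (St G I₀ p) x k) → timed G p (St G I₀ p) x t = I.1 →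
        X = (range t).image x →
        (∀ k, k < t → lam (x k) + 1 ≤ (smallestCell (timed G p (St G I₀ p) x k).1 (timed G p (St G I₀ p) x k).2).card) →
        ∀ k, k < t + 1 → Function.update lam (cgSel I) (hgt G cgSel I) (x' k) + 1 ≤
          (smallestCell (timed G p (St G I₀ p) x' k).1 (timed G p (St G I₀ p) x' k).2).card := by
      intro p t x x' hagx hxt hagree htimed hX hlam k hk
      rcases Nat.lt_succ_iff_lt_or_eq.1 hk with hk | hkt
      · have hne : x k ≠ cgSel I := fun heq => hfreshC _ hx (by rw [hX, ← heq]; exact mem_image_of_mem x (mem_range.2 hk))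
        rw [hagx k hk, Function.update_of_ne hne, hagree k hk.le]
        exact hlam k hk
      · rw [hkt, hxt, Function.update_self, hagree t le_rfl, htimed]
        exact hval
    constructor
    · -- the budget: take a second vertex of the smallest cell as pointer
      obtain ⟨y, hyC, hyx⟩ := exists_mem_ne hOR.2 (cgSel I)
      have hyA : y ∈ I.1.1 := smallestCell_subset _ _ hyC
      obtain ⟨t, x, x', hORc', hxv', hagx, hxt, hagree, htimed, hX, hlam⟩ := hext y hyA (hfreshC y hyC) hyx
      have hyI₀ : y ∈ I₀.1.1 := hsubI₀ hyA
      have hvSt : y ∈ (St G I₀ y).1 := self_mem_atom _ hyI₀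
      have heq0 : ∀ u ∈ (St G I₀ y).1, ∀ u' ∈ (St G I₀ y).1, (St G I₀ y).2 u = (St G I₀ y).2 u' → ∀ w ∈ (St G I₀ y).1,
          ((cellOf (St G I₀ y).1 (St G I₀ y).2 w).filter fun z => G.Adj u z).card =
            ((cellOf (St G I₀ y).1 (St G I₀ y).2 w).filter fun z => G.Adj u' z).card :=
        fun u hu u' hu' hc w hw => equitableIn_atom y hI₀ hu hu' hc hw
      have hconn0 : ∀ S ⊆ (St G I₀ y).1, S.Nonempty → S ≠ (St G I₀ y).1 →
          ∃ a ∈ S, ∃ b ∈ (St G I₀ y).1 \ S, (swGraph G (St G I₀ y).1 (St G I₀ y).2).Adj a b :=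
        fun S hS hSne hSA => atom_connected I₀.1.2 hyI₀ hS hSne hSA
      refine ⟨t + 1, x', fun k => (smallestCell (timed G y (St G I₀ y) x' k).1 (timed G y (St G I₀ y) x' k).2).card,
        length_le_card hORc' hxv', fun i hi j hj hij => ?_, henum t x x' hagx hxt hX,
        hvals y t x x' hagx hxt hagree htimed hX hlam, sum_log_smallestCell_le hORc' hxv' hvSt heq0 hconn0, ?_⟩
      · exact x_injective hORc' hxv' (mem_range.1 (mem_coe.1 hi)) (mem_range.1 (mem_coe.1 hj)) hij
      · intro y' hy'
        rw [mem_insert, not_or] at hy'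
        rw [Function.update_of_ne hy'.1]
        exact hlam0 y' hy'.2
    · -- timed data for the unnamed vertices of the child
      intro v hv hvX'
      rw [mem_insert, not_or] at hvX'
      obtain ⟨t, x, x', hORc', hxv', hagx, hxt, hagree, htimed, hX, hlam⟩ := hext v hv hvX'.2 hvX'.1
      refine ⟨t + 1, x', hORc', hxv', ?_, ⟨0, ?_⟩, henum t x x' hagx hxt hX, hvals v t x x' hagx hxt hagree htimed hX hlam⟩
      · show refineIn G I.1.1 (indiv I.1.2 (cgSel I)) = (timed G v (St G I₀ v) x' (t + 1)).2
        rw [timed_succ, hagree t le_rfl, htimed, hxt]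
        rfl
      · show I.1.1 = (timed G v (St G I₀ v) x' t).1
        rw [hagree t le_rfl, htimed]

/-- **The label budget along the solution subtree**: every label `(block, X, λ)` of the solution subtree of the scheme with heights
(from an equitable start) satisfies `BudgetBound X λ`. -/
theorem reach_budgetBound [Fintype V]
    (hI₀ : ∀ u ∈ I₀.1.1, ∀ u' ∈ I₀.1.1, I₀.1.2 u = I₀.1.2 u' → ∀ w ∈ I₀.1.1,
      ((cellOf I₀.1.1 I₀.1.2 w).filter fun y => G.Adj u y).card = ((cellOf I₀.1.1 I₀.1.2 w).filter fun y => G.Adj u' y).card)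
    {I : (cgProcess G).Inst} {X : Finset V} {lam : V → ℕ}
    (h : CertifiedLabels.Reach (cgProcess G) (cgSel (V := V)) (hgt G cgSel) I₀ I X lam) : BudgetBound X lam :=
  (reach_budget hI₀ h).1

end BranchSum

end Summit.PneNP.PneNP.Theorems
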